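import Literature.MathematicalPhysics.QuantumFieldTheory.PointwiseOSReconstruction
import Literature.Probability.LatticeModels.CriticalWickDichotomy
import Literature.Probability.LatticeModels.CriticalScalingDimension
import Summits.CriticalPhenomena.Ising3DConformalLimit.Theses.HyperoctahedralRP
import Summits.CriticalPhenomena.Ising3DConformalLimit.Theorems.InversionUpgradeNormalised.Negative.AutomaticOrders
import Summits.CriticalPhenomena.Ising3DConformalLimit.Theorems.HyperoctahedralRPInversionUpgradeNormalisedEvenPos
import HarnessLib

/-!
# The Osterwalder–Schrader premises of a pointwise scaling limit of the critical `ℤ³` correlators: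
# stub `stub_osLayer` of line `free-endpoint-gaussian-closure` for crux `InversionUpgradeNormalised`
# (stmt-CriticalPhenomena-1982)

Statement.  Assume Gaussian domination in the scaling limit (the statement of the landed stub
`stub_gaussianDomination`: `S_{2n}(x) ≤ 𝒢_n[S₂](x)` on non-coincident `x` for every pointwise scaling
limit `S` of `criticalCorr 3`).  Let `S` be a pointwise scaling limit of `criticalCorr 3` under a
renormalisation `ρ > 0` on `(0,1]` which is normalised (`S = 0` off `NonCoincident`), has
non-degenerate two-point function, is Euclidean invariant and scale covariant with weight `Δ`, and is
reflection positive along the axis `τ` (the conclusion of the landed stub `stub_osReflectionPositive`).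
Then `S` satisfies ALL premises `PointwiseOSReconstruction τ S` of the pointwise Osterwalder–Schrader
reconstruction along `τ` (Glimm–Jaffe 1987, Thm. 6.1.3): reflection positivity, `θ_τ`-invariance,
permutation symmetry, translation invariance and polynomial time growth of the OS kernel.

Proof of the four remaining fields.
* `θ_τ`-invariance and translation invariance are the two halves of Euclidean invariance
  (`IsEuclideanInvariant = IsTranslationInvariant ∧ IsRotationInvariant`, reflections included).
* Permutation symmetry (E3) is EXACT on the lattice: the spin monomial `∏ᵢ σ_{k(σ i)}` equals
  `∏ᵢ σ_{kᵢ}` (`Equiv.prod_comp`), so the rescaled correlators at `x ∘ σ` and at `x` coincide for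
  every mesh and the two limits agree (`tendsto_nhds_unique`); off `NonCoincident` both sides vanish
  by the normalisation.
* Polynomial time growth, with exponent `N = 0` (the kernel is BOUNDED in `t ≥ 0`).  For half-space
  configurations `a, b` the kernel entry `K_S(a, T(t) b)` is `S_m(Z_t)`, `m = |a| + |b|`,
  `Z_t = (θ_τ a, b + t e_τ)` (non-coincident).  If `m` is odd, `S_m ≡ 0` (`m*(β_c) = 0`, tree
  `HasPointwiseScalingLimit.eq_zero_of_odd`, through `InversionUpgradeNormalisedNegative.limit_odd_eq_zero`).
  If `m = 2r`, then `0 < S_m(Z_t)` (landed `InversionDefectInvolution.stub_evenPos`) and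
  `S_m(Z_t) ≤ 𝒢_r[S₂](Z_t)` (Gaussian domination).  Every factor of the pairing functional is a
  two-point function at two DISTINCT points of `Z_t`, `S₂(u,v) = ‖u-v‖^{-2Δ} S₂(0,e₀)`
  (`InversionUpgradeNormalisedNegative.two_point_eq`) with `Δ ≥ 1/2 > 0` (`delta_mem_Icc_of_hyp`,
  infrared bound), hence ANTITONE in the distance `‖u - v‖`; and every pairwise distance in `Z_t` is at
  least the corresponding distance in `Z_0 = (θ_τ a, b)`: inside each block the distances do not depend
  on `t`, across the blocks `‖θ_τ aᵢ - bⱼ - t e_τ‖ ≥ ‖θ_τ aᵢ - bⱼ‖` because the `τ`-coordinate of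
  `θ_τ aᵢ - bⱼ` is `-(aᵢ)_τ - (bⱼ)_τ < 0 ≤ t`.  So `S_m(Z_t) ≤ 𝒢_r[S₂](Z_0)`, a `t`-independent
  bound.

References: J. Glimm, A. Jaffe, *Quantum Physics* (2nd ed., Springer 1987), §6.1, Thm. 6.1.3;
K. Osterwalder, R. Schrader, Comm. Math. Phys. 31 (1973), §4.1, (4.8) (the growth bound).
No definitions are introduced.
-/

noncomputable section

open Filter Topology
open Literature.Probability.LatticeModels Literature.MathematicalPhysics.QuantumFieldTheory

namespace Summit.CriticalPhenomena.Ising3DConformalLimit.Cruxes.InversionUpgradeNormalised.FreeEndpointGaussianClosure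

/-! ### Permutation symmetry: exact on the lattice, inherited by the limit -/

/-- The critical correlators `⟨∏ᵢ σ_{kᵢ}⟩_{β_c}` are symmetric functions of the sites: relabelling
the sites by a permutation `σ` does not change the spin monomial (`Equiv.prod_comp`). -/
theorem criticalCorr_comp_perm {n : ℕ} (σ : Equiv.Perm (Fin n)) (k : Fin n → Site 3) :
    criticalCorr 3 n (k ∘ σ) = criticalCorr 3 n k := by
  have h : spinMonomial (k ∘ σ) = spinMonomial k := by
    funext s
    simp only [spinMonomial, Function.comp_apply]
    exact Equiv.prod_comp σ (fun i => spinAt (k i) s)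
  show plusExpect 3 (criticalBeta 3) 0 (spinMonomial (k ∘ σ)) =
    plusExpect 3 (criticalBeta 3) 0 (spinMonomial k)
  rw [h]

/-- The rescaled critical correlators at mesh `δ` are symmetric functions of the points. -/
theorem rescaledCorrelator_comp_perm (ρ : ℝ → ℝ) {n : ℕ} (σ : Equiv.Perm (Fin n)) (δ : ℝ)
    (x : Fin n → EuclideanSpace ℝ (Fin 3)) :
    rescaledCorrelator (criticalCorr 3) ρ n δ (x ∘ σ) =
      rescaledCorrelator (criticalCorr 3) ρ n δ x := by
  simp only [rescaledCorrelator_apply, Function.comp_apply]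
  exact congrArg _ (criticalCorr_comp_perm σ fun i => latticeApprox δ (x i))

/-- **Permutation symmetry (E3) of a normalised pointwise scaling limit of `criticalCorr 3`.**  On
`NonCoincident` the rescaled correlators at `x ∘ σ` and `x` coincide for every mesh, so their limits
agree (`tendsto_nhds_unique` along `𝓝[>] 0`); off `NonCoincident` both sides vanish. -/
theorem isPermutationSymmetric_of_limit {ρ : ℝ → ℝ} {S : CorrFamily 3}
    (hlim : HasPointwiseScalingLimit (criticalCorr 3) ρ S)
    (hnorm : ∀ n z, z ∉ NonCoincident 3 n → S n z = 0) : IsPermutationSymmetric S := by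
  intro n σ x
  by_cases hx : Function.Injective x
  · have hxσ : (x ∘ σ) ∈ NonCoincident 3 n := hx.comp σ.injective
    have h1 := (hlim n).tendsto_at hxσ
    have h2 := (hlim n).tendsto_at (show x ∈ NonCoincident 3 n from hx)
    exact tendsto_nhds_unique (h1.congr fun δ => rescaledCorrelator_comp_perm ρ σ δ x) h2
  · have hxσ : ¬ Function.Injective (x ∘ σ) := fun h =>
      hx ((Function.Injective.of_comp_iff' x σ.bijective).1 h)
    rw [hnorm n _ hxσ, hnorm n _ hx]

/-! ### Geometry: time translation pushes the two blocks of the kernel argument apart -/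

/-- Pushing a vector with non-positive `τ`-coordinate further down along `e_τ` does not decrease
its norm: `‖w‖ ≤ ‖w - t e_τ‖` for `w_τ ≤ 0 ≤ t`. -/
theorem norm_le_norm_sub_single (τ : Fin 3) {w : EuclideanSpace ℝ (Fin 3)} (hw : w τ ≤ 0)
    {t : ℝ} (ht : 0 ≤ t) : ‖w‖ ≤ ‖w - EuclideanSpace.single τ t‖ := by
  refine le_of_pow_le_pow_left₀ two_ne_zero (norm_nonneg _) ?_
  rw [EuclideanSpace.real_norm_sq_eq, EuclideanSpace.real_norm_sq_eq]
  refine Finset.sum_le_sum fun k _ => ?_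
  rw [PiLp.sub_apply, PiLp.single_apply]
  split_ifs with hk
  · subst hk
    nlinarith
  · rw [sub_zero]

/-- **All pairwise distances in the kernel argument grow under time translation.**  For half-space
configurations `a, b` along `τ` and `t ≥ 0`, every pairwise distance in `(θ_τ a, b + t e_τ)` is at
least the corresponding distance in `(θ_τ a, b)`: inside the blocks the distances do not depend on
`t`; across, the `τ`-coordinate of `θ_τ aᵢ - bⱼ` is `-(aᵢ)_τ - (bⱼ)_τ < 0`. -/
theorem norm_sub_le_norm_sub_shift {τ : Fin 3} (a b : HalfSpaceConfig 3 τ) {t : ℝ} (ht : 0 ≤ t)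
    (i j : Fin (a.n + b.n)) :
    ‖Fin.append (fun i => axisReflection τ (a.pts i)) b.pts i -
        Fin.append (fun i => axisReflection τ (a.pts i)) b.pts j‖ ≤
      ‖Fin.append (fun i => axisReflection τ (a.pts i))
          (fun j => b.pts j + EuclideanSpace.single τ t) i -
        Fin.append (fun i => axisReflection τ (a.pts i))
          (fun j => b.pts j + EuclideanSpace.single τ t) j‖ := by
  have hcross : ∀ (i' : Fin a.n) (j' : Fin b.n),
      ‖axisReflection τ (a.pts i') - b.pts j'‖ ≤
        ‖axisReflection τ (a.pts i') - (b.pts j' + EuclideanSpace.single τ t)‖ := by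
    intro i' j'
    rw [sub_add_eq_sub_sub]
    refine norm_le_norm_sub_single τ ?_ ht
    rw [PiLp.sub_apply, axisReflection_apply, if_pos rfl]
    linarith [a.pos i', b.pos j']
  refine Fin.addCases (fun i' => ?_) (fun i' => ?_) i <;>
    refine Fin.addCases (fun j' => ?_) (fun j' => ?_) j <;>
    simp only [Fin.append_left, Fin.append_right]
  · exact le_rfl
  · exact hcross i' j'
  · rw [norm_sub_rev, norm_sub_rev (b.pts i' + _)]
    exact hcross j' i'
  · rw [add_sub_add_right_eq_sub]

/-! ### The two-point function is antitone in the distance; so is the pairing functional -/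

/-- For a non-degenerate, Euclidean-invariant, scale-covariant family with `Δ ≥ 0` the two-point
function `S₂(u,v) = ‖u-v‖^{-2Δ} S₂(0,e₀)` (`two_point_eq`) is antitone in the distance:
`‖u - v‖ ≤ ‖u' - v'‖`, `u ≠ v` imply `S₂(u',v') ≤ S₂(u,v)`. -/
theorem two_point_le_of_norm_le {Δ : ℝ} {S : CorrFamily 3} (hnd : IsNondegenerateTwoPoint S)
    (heuc : IsEuclideanInvariant S) (hsc : IsScaleCovariant Δ S) (hΔ : 0 ≤ Δ)
    {u v u' v' : EuclideanSpace ℝ (Fin 3)} (huv : u ≠ v) (h : ‖u - v‖ ≤ ‖u' - v'‖) :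
    S 2 ![u', v'] ≤ S 2 ![u, v] := by
  have hpos : 0 < ‖u - v‖ := norm_pos_iff.2 (sub_ne_zero.2 huv)
  have hu'v' : u' ≠ v' := by
    intro he
    rw [he, sub_self, norm_zero] at h
    exact absurd h (not_le.2 hpos)
  rw [InversionUpgradeNormalisedNegative.two_point_eq heuc hsc huv,
    InversionUpgradeNormalisedNegative.two_point_eq heuc hsc hu'v']
  have hK : 0 ≤ S 2 ![0, EuclideanSpace.single 0 1] :=
    (hnd _ (pair_mem_nonCoincident fun h0 =>
      one_ne_zero ((PiLp.single_eq_zero_iff _ _).1 h0.symm))).le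
  exact mul_le_mul_of_nonneg_right (Real.rpow_le_rpow_of_nonpos hpos h (by linarith)) hK

/-- **The pairing functional is antitone in the distances.**  If `x, y : Fin (2r) → ℝ³` are
injective and every pairwise distance in `x` is at most the corresponding one in `y`, then
`𝒢_r[S₂](y) ≤ 𝒢_r[S₂](x)`: termwise comparison of products of non-negative factors
(`Finset.prod_le_prod`), each factor being a two-point function at two distinct indices. -/
theorem pairingSum_le_of_norm_le {Δ : ℝ} {S : CorrFamily 3} (hnd : IsNondegenerateTwoPoint S)
    (heuc : IsEuclideanInvariant S) (hsc : IsScaleCovariant Δ S) (hΔ : 0 ≤ Δ) {r : ℕ}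
    {x y : Fin (2 * r) → EuclideanSpace ℝ (Fin 3)} (hx : Function.Injective x)
    (hy : Function.Injective y) (h : ∀ i j, ‖x i - x j‖ ≤ ‖y i - y j‖) :
    pairingSum (fun u v => S 2 ![u, v]) r y ≤ pairingSum (fun u v => S 2 ![u, v]) r x := by
  unfold pairingSum
  refine mul_le_mul_of_nonneg_left (Finset.sum_le_sum fun σ _ =>
    Finset.prod_le_prod (fun j _ => ?_) (fun j _ => ?_)) (by positivity)
  · have hne : σ (pairIdx r (j, 0)) ≠ σ (pairIdx r (j, 1)) := fun he => by
      have := (pairIdx r).injective (σ.injective he)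
      simp at this
    exact (hnd _ (pair_mem_nonCoincident (hy.ne hne))).le
  · have hne : σ (pairIdx r (j, 0)) ≠ σ (pairIdx r (j, 1)) := fun he => by
      have := (pairIdx r).injective (σ.injective he)
      simp at this
    exact two_point_le_of_norm_le hnd heuc hsc hΔ (hx.ne hne) (h _ _)

/-! ### The uniform bound of the OS kernel under time translation -/

/-- Re-indexing a configuration along `Fin.cast` does not change the correlation. -/
theorem corr_comp_cast (S : CorrFamily 3) {k l : ℕ} (h : k = l)
    (z : Fin l → EuclideanSpace ℝ (Fin 3)) : S k (z ∘ Fin.cast h) = S l z := by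
  subst h
  rfl

/-- **The OS kernel is bounded under time translation** (pointwise form of Osterwalder–Schrader
1973, (4.8), here with a constant bound).  Under Gaussian domination in the limit and the crux
hypotheses, for half-space configurations `a, b` there is `C` with `|K_S(a, T(t) b)| ≤ C` for all
`t ≥ 0`: odd total order vanishes identically; for even total order `2r`,
`0 < S_{2r}(θ_τ a, b + t e_τ) ≤ 𝒢_r[S₂](θ_τ a, b + t e_τ) ≤ 𝒢_r[S₂](θ_τ a, b) = C`
(`stub_evenPos`, Gaussian domination, `pairingSum_le_of_norm_le` with
`norm_sub_le_norm_sub_shift`). -/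
theorem exists_abs_osPointKernel_timeShift_le
    (hGD : ∀ (ρ : ℝ → ℝ) (S : CorrFamily 3), (∀ δ ∈ Set.Ioc (0:ℝ) 1, 0 < ρ δ) →
      HasPointwiseScalingLimit (criticalCorr 3) ρ S →
      ∀ (n : ℕ) (x : Fin (2 * n) → EuclideanSpace ℝ (Fin 3)), x ∈ NonCoincident 3 (2 * n) →
        S (2 * n) x ≤ pairingSum (fun a b => S 2 ![a, b]) n x)
    {ρ : ℝ → ℝ} {Δ : ℝ} {S : CorrFamily 3} (hρ : ∀ δ ∈ Set.Ioc (0:ℝ) 1, 0 < ρ δ)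
    (hlim : HasPointwiseScalingLimit (criticalCorr 3) ρ S)
    (hnorm : ∀ n z, z ∉ NonCoincident 3 n → S n z = 0) (hnd : IsNondegenerateTwoPoint S)
    (heuc : IsEuclideanInvariant S) (hsc : IsScaleCovariant Δ S) (hΔ : 0 ≤ Δ) {τ : Fin 3}
    (a b : HalfSpaceConfig 3 τ) :
    ∃ C : ℝ, ∀ t : ℝ, 0 ≤ t → |osPointKernel S a (b.timeShift t)| ≤ C := by
  -- the kernel entry at time `t ≥ 0`, unfolded, and injectivity of its argument
  have hker : ∀ {t : ℝ}, 0 ≤ t → osPointKernel S a (b.timeShift t) =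
      S (a.n + b.n) (Fin.append (fun i => axisReflection τ (a.pts i))
        (fun j => b.pts j + EuclideanSpace.single τ t)) := fun ht => by
    rw [HalfSpaceConfig.timeShift_of_nonneg ht]
    rfl
  have hinj : ∀ {t : ℝ}, 0 ≤ t → Function.Injective
      (Fin.append (fun i => axisReflection τ (a.pts i))
        (fun j => b.pts j + EuclideanSpace.single τ t)) := fun {t} ht =>
    osPointKernel_arg_injective a (b.translate (EuclideanSpace.single τ t) (by simpa using ht))
  rcases Nat.even_or_odd (a.n + b.n) with ⟨r, hr⟩ | hodd
  · -- even total order `2r`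
    have h2 : 2 * r = a.n + b.n := by omega
    have h0 : Function.Injective (Fin.append (fun i => axisReflection τ (a.pts i)) b.pts) :=
      osPointKernel_arg_injective a b
    refine ⟨pairingSum (fun u v => S 2 ![u, v]) r
      (Fin.append (fun i => axisReflection τ (a.pts i)) b.pts ∘ Fin.cast h2), fun t ht => ?_⟩
    rw [hker ht]
    have hpos : 0 < S (a.n + b.n) (Fin.append (fun i => axisReflection τ (a.pts i))
        (fun j => b.pts j + EuclideanSpace.single τ t)) :=
      InversionDefectInvolution.stub_evenPos ρ S hρ hlim hnd _ ⟨r, hr⟩ _ (hinj ht)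
    rw [abs_of_pos hpos, ← corr_comp_cast S h2]
    calc S (2 * r) (Fin.append (fun i => axisReflection τ (a.pts i))
            (fun j => b.pts j + EuclideanSpace.single τ t) ∘ Fin.cast h2)
        ≤ pairingSum (fun u v => S 2 ![u, v]) r
            (Fin.append (fun i => axisReflection τ (a.pts i))
              (fun j => b.pts j + EuclideanSpace.single τ t) ∘ Fin.cast h2) :=
          hGD ρ S hρ hlim r _ ((hinj ht).comp (Fin.cast_injective h2))
      _ ≤ pairingSum (fun u v => S 2 ![u, v]) r
            (Fin.append (fun i => axisReflection τ (a.pts i)) b.pts ∘ Fin.cast h2) :=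
          pairingSum_le_of_norm_le hnd heuc hsc hΔ (h0.comp (Fin.cast_injective h2))
            ((hinj ht).comp (Fin.cast_injective h2))
            fun i j => norm_sub_le_norm_sub_shift a b ht _ _
  · -- odd total order: the kernel entry vanishes
    exact ⟨0, fun t ht => by
      rw [hker ht, InversionUpgradeNormalisedNegative.limit_odd_eq_zero hlim hnorm hodd, abs_zero]⟩

/-! ### The registered stub -/

/-- **stub_osLayer** (the OS premises of the scaling limit; Glimm–Jaffe 1987, §6.1, Thm. 6.1.3).
Given Gaussian domination in the limit (statement of `stub_gaussianDomination`) and reflection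
positivity along `τ` (conclusion of `stub_osReflectionPositive`), every normalised, non-degenerate,
Euclidean-invariant, scale-covariant pointwise scaling limit `S` of `criticalCorr 3` satisfies
`PointwiseOSReconstruction τ S`: `θ_τ`-invariance and translation invariance are the two halves of
Euclidean invariance; permutation symmetry is exact on the lattice and passes to the limit
(`isPermutationSymmetric_of_limit`); the OS kernel is bounded under time translation
(`exists_abs_osPointKernel_timeShift_le`, using `Δ ≥ 1/2` from `delta_mem_Icc_of_hyp`), which is
polynomial growth with exponent `0`. -/
theorem stub_osLayer :
    (∀ (ρ : ℝ → ℝ) (S : CorrFamily 3), (∀ δ ∈ Set.Ioc (0:ℝ) 1, 0 < ρ δ) →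
      HasPointwiseScalingLimit (criticalCorr 3) ρ S →
      ∀ (n : ℕ) (x : Fin (2 * n) → EuclideanSpace ℝ (Fin 3)), x ∈ NonCoincident 3 (2 * n) →
        S (2 * n) x ≤ pairingSum (fun a b => S 2 ![a, b]) n x) →
    ∀ (ρ : ℝ → ℝ) (Δ : ℝ) (S : CorrFamily 3), (∀ δ ∈ Set.Ioc (0:ℝ) 1, 0 < ρ δ) →
      HasPointwiseScalingLimit (criticalCorr 3) ρ S → (∀ n z, z ∉ NonCoincident 3 n → S n z = 0) →
      IsNondegenerateTwoPoint S → IsEuclideanInvariant S → IsScaleCovariant Δ S →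
      ∀ τ : Fin 3, IsReflectionPositiveAlong τ S → PointwiseOSReconstruction τ S := by
  intro hGD ρ Δ S hρ hlim hnorm hnd heuc hsc τ hRP
  have hΔ : 0 ≤ Δ := by
    have h := (InversionUpgradeNormalisedNegative.delta_mem_Icc_of_hyp hρ hlim hnd hsc).1
    linarith
  exact
    { reflectionPositive := hRP
      reflectionInvariant := fun n x => heuc.2 n (axisReflection τ) x
      symmetric := isPermutationSymmetric_of_limit hlim hnorm
      translationInvariant := heuc.1
      polynomialGrowth := fun a b => by
        obtain ⟨C, hC⟩ :=
          exists_abs_osPointKernel_timeShift_le hGD hρ hlim hnorm hnd heuc hsc hΔ a b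
        exact ⟨C, 0, fun t ht => by simpa using hC t ht⟩ }

end Summit.CriticalPhenomena.Ising3DConformalLimit.Cruxes.InversionUpgradeNormalised.FreeEndpointGaussianClosure

end
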